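import Literature.NumberTheory.Automorphic.UnitaryCurveCohCotangentForms
import Literature.NumberTheory.Automorphic.UnitaryGroupArchCenter
import HarnessLib

/-!
# Crux `HLiu418`, line LD2 (organ B₂, node «`χ_∞ = 1`») — the archimedean centre acts trivially on the rank-2 holomorphic cotangent forms
# `holCotForms₂`: the `n = 2`, cone-model twin of ★ `UnitaryGroupHolCotFormsArchCentre` (n = 3, ball model)

Cell hodgecm-mathlib (D-0151), FLOOR 0; crux item `HLiu418` = stmt-HodgeConjecture-24832; half-A line LD2 (socket `stub_S1b_facts`), organ B₂
`ThetaFinComponent₂` («the finite component of a theta lift from a line is `ω(μ′, ε_{a′}, χ′)_f` for some `χ′ ∈ Chi`», n = 2 twin of ★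
`Liu2021.meetsThetaLiftFromLine_hasFinComponent_rhoAtLine`): its n = 3 proof descends the theta character `χ̃` to `Chi` through «`χ_∞ = 1`» (★
`ThetaLiftFromLineCentralCharacter.charCM_archCentre_eq_one_of_holCotForm` over ★ `CotangentForms.centralCharacter_archCentre_eq_one`, BALL model,
`Fin 3`).  This file is the rank-2 input of that step, over the CONE carriers ★ `UnitaryCurveForms.holCotForms₂` (A-p01 (g12)).  Seat LD2-p02 (g0).
THEOREMS ONLY (no `def`, no instance, no notation, no named fact, no `sorry`); `--supports stmt-HodgeConjecture-24832 --as helper`.  HC_CM is proved only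
modulo the 7 printed citations (2 remaining: hLiu418, h413) until rung 0 closes; this file discharges nothing printed.

THE MATHEMATICS ([BorelJacquet1979, §4.1]; [Borel1997, §5.14]; [Liu2021, proof of Prop. 4.13 Case 1, l. 2137 «the central character `χ` of `π`
satisfies `χ_∞ = 1`»]).  The archimedean central element `(y·1₂, 1) ∈ U(H)(𝔸_{L⁺})` (`y` an archimedean norm-one unit, ★ `cmArchCenter`) splits at
the complex place `w₁` as `adelicSingle w₁ (u) · k` with `u = (y·1₂)_{w₁} = λ·1₂` a SCALAR of `U(H^{σ_{w₁}})` (`λ = y_{w₁}`) and `k` in the compact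
factor `K_c(w₁) = (ker archAt w₁).map archToAdelic` (★ `UnitaryGroupArchFactor.exists_eq_archSingle_mul`).  A holomorphic cotangent form `f` is
right-`K_c(w₁)`-invariant (clause (Kc)) and its `w₁`-slice obeys the COTANGENT LAW of the cone frame `𝔣 = (v₀, t₀)` (clause (H), ★ `IsConeHol`):
`Φ(g b) = (a k⁻¹) Φ(g)` for `b v₀ = k v₀`, `b t₀ = a t₀ + d v₀`; a scalar `b = λ·1₂` has `k = a = λ`, `d = 0`, so `Φ(u) = Φ(1)` and
`f(x · (y·1₂, 1)) = f(x)` (§3).  Hence the `L²`-class of `f` is FIXED by `R((y,1)·1₂)` (§4) and every central character `ψ_P` of a discrete `P`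
containing a non-zero such class is `1` on the archimedean centre (§5) — «`χ_∞ = 1`» at rank 2, with NO chart and no Jacobian (the cone law
replaces the ball's isotropy computation ★ `Jac_eq_one_of_mat_eq_smul`).

* §1 `coe_archAt_cmArchCenter` — `(y·1₂)_{w₁} = y_{w₁} • 1₂`; `snd_ringEquiv_mixedSpace_ne_zero` — `y_{w₁} ≠ 0`;
* §2 `exists_archToAdelic_cmArchCenter_eq` — `(y·1₂, 1) = adelicSingle w₁ ((y·1₂)_{w₁}) · k`, `k ∈ K_c(w₁)`;
* §3 **`apply_mul_archToAdelic_cmArchCenter₂`** — `f (x · (y·1₂, 1)) = f x` for `f ∈ holCotForms₂ … 𝔣`;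
* §4 `left_inv_of_mem_holCotForms₂`, **`rightRegular_archCentre_toLp_toQuotFun₂`** — `R((y,1)·1₂) [f] = [f]`;
* §5 **`centralCharacter_archCentre_eq_one₂`** — `ψ_P((y,1)) = 1`.

## References
* [BorelJacquet1979] A. Borel, H. Jacquet, *Automorphic forms and automorphic representations*, PSPM 33.1 (1979), §4.1, §4.6.
* [Borel1997] A. Borel, *Automorphic forms on SL₂(ℝ)*, Cambridge Tracts 130 (1997), §5.13–§5.14.
* [Liu2021] Y. Liu, Camb. J. Math. 9 (2021), proof of Prop. 4.13 Case 1, l. 2137 («`χ_∞ = 1`»); App. D l. 5357–5359.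
* [Mok2014] C. P. Mok, Mem. AMS 235 (2015), §1 Notation p. 5 (`U(1)` = centre of `U(N)`).
-/

set_option autoImplicit false
-- the mandated namespace has the single-problem summit's repeated segment (`HodgeConjecture.HodgeConjecture`)
set_option linter.dupNamespace false

noncomputable section

open NumberField NumberField.InfinitePlace NumberField.mixedEmbedding MeasureTheory Matrix
open scoped ComplexConjugate ComplexOrder Matrix

namespace Summit.HodgeConjecture.HodgeConjecture.Cruxes.HLiu418.F0LD2CurveHolCotFormsArchCentre

open Literature.NumberTheory.Automorphic Literature.NumberTheory.Automorphic.UnitaryGroup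
open Literature.NumberTheory.Automorphic.UnitaryGroup.CotangentForms (toQuotFun toQuotFun_mk)
open Literature.NumberTheory.Automorphic.UnitaryCurveForms
open Literature.AlgebraicGeometry.ShimuraVarieties

variable (L : Type) [Field L] [NumberField L] [IsCMField L] (H : Matrix (Fin 2) (Fin 2) L) (w₁ : {w : InfinitePlace L // IsComplex w})

/-! ## §1 The `w₁`-component of the archimedean centre is a scalar -/

/-- **`(y·1₂)_{w₁} = y_{w₁} • 1₂`**: the `w₁`-component of the archimedean central element `y·1₂` is the scalar matrix of the `w₁`-coordinate of `y`
(★ `coe_archAt_apply`, ★ `coe_archCenter`). [cite: BorelJacquet1979, §4.1] [cite: Mok2014, §1 Notation p. 5] -/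
theorem coe_archAt_cmArchCenter (y : relNormOneInfUnits (↥(maximalRealSubfield L)) L) :
    (((archAt (↥(maximalRealSubfield L)) L (IsCMField.complexConj L) 2 H w₁ (complexConj_smul_infinitePlace L w₁.1)
        (IsCMField.complexConj_ne_one L) (cmArchCenter L 2 H y) : archLocal L 2 H w₁) : GL (Fin 2) ℂ) : Matrix (Fin 2) (Fin 2) ℂ) =
      ((InfiniteAdeleRing.ringEquiv_mixedSpace L ((y : (InfiniteAdeleRing L)ˣ) : InfiniteAdeleRing L)).2 w₁) •
        (1 : Matrix (Fin 2) (Fin 2) ℂ) := by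
  ext i j
  rw [coe_archAt_apply, cmArchCenter_eq, coe_archCenter, Matrix.smul_apply, Matrix.smul_apply, smul_eq_mul, smul_eq_mul]
  by_cases hij : i = j
  · subst hij
    rw [Matrix.one_apply_eq, Matrix.one_apply_eq, mul_one, mul_one]
  · rw [Matrix.one_apply_ne hij, Matrix.one_apply_ne hij, mul_zero, mul_zero, Prod.snd_zero, Pi.zero_apply]

omit [IsCMField L] in
/-- The `w₁`-coordinate of an archimedean unit is non-zero. [folklore] -/
theorem snd_ringEquiv_mixedSpace_ne_zero (y : relNormOneInfUnits (↥(maximalRealSubfield L)) L) :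
    (InfiniteAdeleRing.ringEquiv_mixedSpace L ((y : (InfiniteAdeleRing L)ˣ) : InfiniteAdeleRing L)).2 w₁ ≠ 0 := by
  intro h0
  have h := congrArg (fun s : mixedSpace L => s.2 w₁)
    (show InfiniteAdeleRing.ringEquiv_mixedSpace L ((y : (InfiniteAdeleRing L)ˣ) : InfiniteAdeleRing L) *
        InfiniteAdeleRing.ringEquiv_mixedSpace L ((y⁻¹ : (InfiniteAdeleRing L)ˣ) : InfiniteAdeleRing L) = 1 by
      rw [← map_mul, Units.mul_inv, map_one])
  simp only [Prod.snd_mul, Pi.mul_apply, Prod.snd_one, Pi.one_apply, h0, zero_mul] at h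
  exact zero_ne_one h

/-! ## §2 The archimedean centre splits at `w₁` into a scalar at `w₁` and an element of the compact factor -/

/-- **`(y·1₂, 1) = adelicSingle w₁ ((y·1₂)_{w₁}) · k` with `k ∈ K_c(w₁) = (ker archAt w₁).map archToAdelic`** (★ `exists_eq_archSingle_mul`, ★
`adelicSingle_apply`). [cite: BorelJacquet1979, §4.1] -/
theorem exists_archToAdelic_cmArchCenter_eq (y : relNormOneInfUnits (↥(maximalRealSubfield L)) L) :
    ∃ k ∈ ((archAt (↥(maximalRealSubfield L)) L (IsCMField.complexConj L) 2 H w₁ (complexConj_smul_infinitePlace L w₁.1)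
        (IsCMField.complexConj_ne_one L)).ker).map (archToAdelic (↥(maximalRealSubfield L)) L (IsCMField.complexConj L) 2 H),
      archToAdelic (↥(maximalRealSubfield L)) L (IsCMField.complexConj L) 2 H (cmArchCenter L 2 H y) =
        adelicSingle (↥(maximalRealSubfield L)) L (IsCMField.complexConj L) 2 H (IsCMField.complexConj_ne_one L)
            (complexConj_smul_infinitePlace L) w₁
            (archAt (↥(maximalRealSubfield L)) L (IsCMField.complexConj L) 2 H w₁ (complexConj_smul_infinitePlace L w₁.1)
              (IsCMField.complexConj_ne_one L) (cmArchCenter L 2 H y)) * k := by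
  obtain ⟨a', ha', h⟩ := exists_eq_archSingle_mul (↥(maximalRealSubfield L)) L (IsCMField.complexConj L) 2 H (IsCMField.complexConj_ne_one L)
    (complexConj_smul_infinitePlace L) w₁ (cmArchCenter L 2 H y)
  refine ⟨archToAdelic (↥(maximalRealSubfield L)) L (IsCMField.complexConj L) 2 H a', ⟨a', MonoidHom.mem_ker.2 ha', rfl⟩, ?_⟩
  conv_lhs => rw [h]
  rw [map_mul, adelicSingle_apply]

/-! ## §3 Holomorphic cotangent forms (rank 2, cone carriers) are invariant under the archimedean centre -/

variable {L H w₁}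

/-- **`f (x · (y·1₂, 1)) = f x` for every `f ∈ holCotForms₂ … 𝔣`**: the compact part `k` of `(y·1₂, 1) = adelicSingle w₁ (λ·1₂) · k` acts trivially
(clause (Kc) of ★ `mem_holCotForms₂_iff`), and the scalar `λ·1₂` acts on the `w₁`-slice through the cotangent law of ★ `IsConeHol` with `k = a = λ`,
`d = 0`: factor `λ λ⁻¹ = 1`. [cite: Borel1997, §5.13–§5.14] [cite: BorelJacquet1979, §4.1] -/
theorem apply_mul_archToAdelic_cmArchCenter₂ {𝔣 : ConeFrame L H w₁}
    {f : (adelicGroupData (↥(maximalRealSubfield L)) L (IsCMField.complexConj L) 2 H).Adelic → ℂ}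
    (hf : f ∈ holCotForms₂ (↥(maximalRealSubfield L)) L (IsCMField.complexConj L) H (IsCMField.complexConj_ne_one L)
      (complexConj_smul_infinitePlace L) w₁ 𝔣)
    (y : relNormOneInfUnits (↥(maximalRealSubfield L)) L)
    (x : (adelicGroupData (↥(maximalRealSubfield L)) L (IsCMField.complexConj L) 2 H).Adelic) :
    f (x * archToAdelic (↥(maximalRealSubfield L)) L (IsCMField.complexConj L) 2 H (cmArchCenter L 2 H y)) = f x := by
  obtain ⟨-, hKc, -, hH⟩ := (mem_holCotForms₂_iff (↥(maximalRealSubfield L)) L (IsCMField.complexConj L) H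
    (IsCMField.complexConj_ne_one L) (complexConj_smul_infinitePlace L) w₁ 𝔣 f).1 hf
  obtain ⟨k, hk, hdec⟩ := exists_archToAdelic_cmArchCenter_eq L H w₁ y
  set u := archAt (↥(maximalRealSubfield L)) L (IsCMField.complexConj L) 2 H w₁ (complexConj_smul_infinitePlace L w₁.1)
    (IsCMField.complexConj_ne_one L) (cmArchCenter L 2 H y) with hu
  set l : ℂ := (InfiniteAdeleRing.ringEquiv_mixedSpace L ((y : (InfiniteAdeleRing L)ˣ) : InfiniteAdeleRing L)).2 w₁ with hl
  have hl0 : l ≠ 0 := snd_ringEquiv_mixedSpace_ne_zero L w₁ y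
  have hcoe : ((u : GL (Fin 2) ℂ) : Matrix (Fin 2) (Fin 2) ℂ) = l • (1 : Matrix (Fin 2) (Fin 2) ℂ) := coe_archAt_cmArchCenter L H w₁ y
  rw [hdec, ← mul_assoc, hKc k hk]
  -- the `w₁`-slice at `x`
  obtain ⟨Φ, hΦ, hΦf⟩ := hH x
  have h1 : f (x * adelicSingle (↥(maximalRealSubfield L)) L (IsCMField.complexConj L) 2 H (IsCMField.complexConj_ne_one L)
      (complexConj_smul_infinitePlace L) w₁ u) = Φ ((u : GL (Fin 2) ℂ) : Matrix (Fin 2) (Fin 2) ℂ) := (hΦf u).symm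
  have h0 : f x = Φ 1 := by
    have h := hΦf 1
    rw [map_one, mul_one] at h
    rw [← h]; rfl
  -- the cotangent law at `(g, b) = (1, λ·1₂)`: `Φ (λ·1₂) = (λ λ⁻¹) Φ 1`
  have hlaw := hΦ.2 1 (l • (1 : Matrix (Fin 2) (Fin 2) ℂ)) l l 0 isUnit_one (by rw [one_mulVec]; exact 𝔣.v₀_mem) hl0
    (by rw [smul_mulVec, one_mulVec]) (by rw [smul_mulVec, one_mulVec, zero_smul, add_zero])
  rw [h1, h0, hcoe, ← one_mul (l • (1 : Matrix (Fin 2) (Fin 2) ℂ)), hlaw, mul_inv_cancel₀ hl0, one_mul]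

/-! ## §4 «`χ_∞ = 1`»: the archimedean centre fixes the `L²`-class of a holomorphic cotangent form -/

/-- A holomorphic cotangent form is left-invariant under `A_G · U(H)(L⁺)` (`A_G = 1` for the unitary datum; clause (L) of ★ `mem_holCotForms₂_iff`).
[cite: BorelJacquet1979, §4.2] -/
theorem left_inv_of_mem_holCotForms₂ {𝔣 : ConeFrame L H w₁}
    {f : (adelicGroupData (↥(maximalRealSubfield L)) L (IsCMField.complexConj L) 2 H).Adelic → ℂ}
    (hf : f ∈ holCotForms₂ (↥(maximalRealSubfield L)) L (IsCMField.complexConj L) H (IsCMField.complexConj_ne_one L)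
      (complexConj_smul_infinitePlace L) w₁ 𝔣) :
    ∀ γ ∈ (adelicGroupData (↥(maximalRealSubfield L)) L (IsCMField.complexConj L) 2 H).quotientSubgroup, ∀ g, f (γ * g) = f g := by
  intro γ hγ g
  obtain ⟨hL, -, -, -⟩ := (mem_holCotForms₂_iff (↥(maximalRealSubfield L)) L (IsCMField.complexConj L) H
    (IsCMField.complexConj_ne_one L) (complexConj_smul_infinitePlace L) w₁ 𝔣 f).1 hf
  have hγ' : γ ∈ (⊥ : Subgroup _) ⊔ (toAdelic (↥(maximalRealSubfield L)) L (IsCMField.complexConj L) 2 H).range := hγ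
  rw [bot_sup_eq] at hγ'
  obtain ⟨γr, rfl⟩ := hγ'
  exact hL γr g

variable {μ : Measure (adelicGroupData (↥(maximalRealSubfield L)) L (IsCMField.complexConj L) 2 H).automorphicQuotient}
  [SMulInvariantMeasure (adelicGroupData (↥(maximalRealSubfield L)) L (IsCMField.complexConj L) 2 H).Adelic
    (adelicGroupData (↥(maximalRealSubfield L)) L (IsCMField.complexConj L) 2 H).automorphicQuotient μ]

/-- **`R((y,1)·1₂) [f] = [f]`**: the archimedean central element fixes the `L²`-class of a holomorphic cotangent form (`R(z)[F] = [F(z⁻¹ • ·)]`,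
Mathlib `DomMulAct.mk_smul_toLp`; `[w] ↦ f(w⁻¹ z) = f(w⁻¹)` by §3). [cite: BorelJacquet1979, §4.6] -/
theorem rightRegular_archCentre_toLp_toQuotFun₂ {𝔣 : ConeFrame L H w₁}
    {f : (adelicGroupData (↥(maximalRealSubfield L)) L (IsCMField.complexConj L) 2 H).Adelic → ℂ}
    (hf : f ∈ holCotForms₂ (↥(maximalRealSubfield L)) L (IsCMField.complexConj L) H (IsCMField.complexConj_ne_one L)
      (complexConj_smul_infinitePlace L) w₁ 𝔣)
    (y : relNormOneInfUnits (↥(maximalRealSubfield L)) L)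
    (h : MemLp (toQuotFun (adelicGroupData (↥(maximalRealSubfield L)) L (IsCMField.complexConj L) 2 H) f) 2 μ) :
    (adelicGroupData (↥(maximalRealSubfield L)) L (IsCMField.complexConj L) 2 H).rightRegular μ
        (archToAdelic (↥(maximalRealSubfield L)) L (IsCMField.complexConj L) 2 H (cmArchCenter L 2 H y)) (h.toLp _) =
      h.toLp _ := by
  have hleft := left_inv_of_mem_holCotForms₂ hf
  have hfun : (fun q : (adelicGroupData (↥(maximalRealSubfield L)) L (IsCMField.complexConj L) 2 H).automorphicQuotient =>
      toQuotFun (adelicGroupData (↥(maximalRealSubfield L)) L (IsCMField.complexConj L) 2 H) f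
        ((archToAdelic (↥(maximalRealSubfield L)) L (IsCMField.complexConj L) 2 H (cmArchCenter L 2 H y))⁻¹ • q)) =
      toQuotFun (adelicGroupData (↥(maximalRealSubfield L)) L (IsCMField.complexConj L) 2 H) f := by
    funext q
    have hsurj : Function.Surjective
        (adelicGroupData (↥(maximalRealSubfield L)) L (IsCMField.complexConj L) 2 H).toAutomorphicQuotient :=
      QuotientGroup.mk_surjective
    obtain ⟨w, rfl⟩ := hsurj q
    show toQuotFun (adelicGroupData (↥(maximalRealSubfield L)) L (IsCMField.complexConj L) 2 H) f
        ((adelicGroupData (↥(maximalRealSubfield L)) L (IsCMField.complexConj L) 2 H).toAutomorphicQuotient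
          ((archToAdelic (↥(maximalRealSubfield L)) L (IsCMField.complexConj L) 2 H (cmArchCenter L 2 H y))⁻¹ * w)) = _
    rw [toQuotFun_mk hleft, toQuotFun_mk hleft, _root_.mul_inv_rev, inv_inv, apply_mul_archToAdelic_cmArchCenter₂ hf y w⁻¹]
  rw [AdelicGroupData.rightRegular_apply, DomMulAct.mk_smul_toLp]
  exact MemLp.toLp_congr _ _ (Filter.EventuallyEq.of_eq hfun)

/-! ## §5 Central characters are trivial on the archimedean centre -/

/-- **«`χ_∞ = 1`» at rank 2** [Liu2021, l. 2137]: if the centre `u ↦ u·1₂` (★ `adelicCenter`) acts on the discrete automorphic `P` through `ψ`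
(★ `DiscreteAutomorphicRep.exists_centralCharacter_adelicCenter`) and `P` contains the NON-ZERO `L²`-class of a holomorphic cotangent form
`f ∈ holCotForms₂ … 𝔣` (the datum of ★ `IsHolCotangentAt₂` once the class is known to be non-zero), then `ψ((y,1)) = 1` for every archimedean
norm-one unit `y` (`(y·1₂, 1) = (y,1)·1₂`, ★ `archToAdelic_cmArchCenter`, and §4). [cite: Liu2021, proof of Prop. 4.13 Case 1, l. 2137]
[cite: BorelJacquet1979, §4.6] -/
theorem centralCharacter_archCentre_eq_one₂ {𝔣 : ConeFrame L H w₁}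
    (P : DiscreteAutomorphicRep (adelicGroupData (↥(maximalRealSubfield L)) L (IsCMField.complexConj L) 2 H) μ)
    {ψ : ↥(adelicOne (↥(maximalRealSubfield L)) L (IsCMField.complexConj L)) →* ℂˣ}
    (hψ : ∀ (u : ↥(adelicOne (↥(maximalRealSubfield L)) L (IsCMField.complexConj L))) (v : P.space.toSubmodule),
      P.space.toContRep (adelicCenter (↥(maximalRealSubfield L)) L (IsCMField.complexConj L) 2 H u) v = ((ψ u : ℂˣ) : ℂ) • v)
    {f : (adelicGroupData (↥(maximalRealSubfield L)) L (IsCMField.complexConj L) 2 H).Adelic → ℂ}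
    (hf : f ∈ holCotForms₂ (↥(maximalRealSubfield L)) L (IsCMField.complexConj L) H (IsCMField.complexConj_ne_one L)
      (complexConj_smul_infinitePlace L) w₁ 𝔣)
    (h : MemLp (toQuotFun (adelicGroupData (↥(maximalRealSubfield L)) L (IsCMField.complexConj L) 2 H) f) 2 μ)
    (hmem : h.toLp _ ∈ P.space.toSubmodule) (hne : h.toLp _ ≠ 0)
    (y : relNormOneInfUnits (↥(maximalRealSubfield L)) L) :
    ψ ((cmAdelicOneEquivRelNormOne L).symm (relNormOneInfToIdeles (↥(maximalRealSubfield L)) L y)) = 1 := by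
  have hfix := rightRegular_archCentre_toLp_toQuotFun₂ (μ := μ) hf y h
  rw [archToAdelic_cmArchCenter] at hfix
  set u := (cmAdelicOneEquivRelNormOne L).symm (relNormOneInfToIdeles (↥(maximalRealSubfield L)) L y) with hu
  have hv : P.space.toContRep (adelicCenter (↥(maximalRealSubfield L)) L (IsCMField.complexConj L) 2 H u) ⟨_, hmem⟩ = ⟨_, hmem⟩ :=
    Subtype.ext hfix
  have hne' : (⟨_, hmem⟩ : P.space.toSubmodule) ≠ 0 := fun h0 => hne (congrArg Subtype.val h0)
  have hh := hψ u ⟨_, hmem⟩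
  rw [hv] at hh
  have h' : ((ψ u : ℂˣ) : ℂ) • (⟨_, hmem⟩ : P.space.toSubmodule) = (1 : ℂ) • ⟨_, hmem⟩ := by rw [one_smul]; exact hh.symm
  exact Units.ext (smul_left_injective ℂ hne' h')

end Summit.HodgeConjecture.HodgeConjecture.Cruxes.HLiu418.F0LD2CurveHolCotFormsArchCentre

end
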